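import Summits.Ventures.CertifiedQuantumChemistry.Rows.SpinSquaredPenalty
import Literature.MathematicalPhysics.QuantumChemistry.RelaxationEnergyAttained
import Mathlib.Topology.Order.MonotoneConvergence
import HarnessLib

/-!
# Ventures/CertifiedQuantumChemistry — Rows/SpinSquaredPenaltyDuality.lean: the singlet row
# `⟨Ŝ²⟩ = 0` is a FREE MULTIPLIER on the square — `E_PQG(2n, S = 0) = sup_μ E_PQG(Ĥ + μ Ŝ²; ·)`

HONEST FRAMING (verbatim): certified bounds for a stated model Hamiltonian in a stated basis; not a
claim about the real molecule beyond that model.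

Seat rdm-B (gen 21), ROWS file: theorems only (no `def`, no notation), zero compute, nothing landed is
touched; the typer's adopt / refactor / retire word applies. Part 2 of 2 (part 1:
`Rows/SpinSquaredPenalty.lean` — the spin-free tables `(h, g − μ·[q = r][p = s], h_nuc + μ·n(2 − n))` of
`Ĥ + μŜ²` on the `N = 2n` sector and the penalty functional `n(2 − n) − ½ Y(Γ) = ⟨Ŝ²⟩`, non-negative on
the DQG-feasible set and zero exactly on the singlet-feasible set). THIS FILE TYPES the sentence of
`HOME/STRUCTURE.md` §2.2.1 (ii): "the scalar row `⟨Ŝ²⟩ = 0` is exactly a free multiplier on that square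
(`OPT_DQG+S² = sup_μ OPT_DQG(H + μŜ²)`, Lagrangian duality on one linear functional of the 2-RDM)" for the
tree's programme values `pqgEnergy` (`N`-electron DQG), `pqgSectorEnergy` (`S_z`-sector DQG — the cell's
`DQG` instances) and `pqgSingletEnergy` (singlet-restricted DQG — the cell's `DQG+S²` instances), WITHOUT
any constraint qualification: the feasible sets are compact (`RelaxationEnergyAttained.lean`), the penalty
is continuous, non-negative on them and vanishes exactly on the singlet-feasible set — so the penalty
method converges, monotonically, to the constrained value.

* §1 WEAK DUALITY and SHAPE: `pqgEnergy_spinPenalty_le_pqgSingletEnergy`,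
  `pqgSectorEnergy_spinPenalty_le_pqgSingletEnergy` (every penalised value is `≤ E_PQG(2n, S = 0)`, any
  real `μ`), `pqgEnergy_spinPenalty_le_pqgSectorEnergy_spinPenalty`, `monotone_pqgEnergy_spinPenalty`,
  `monotone_pqgSectorEnergy_spinPenalty` (non-decreasing in `μ`), `concaveOn_pqgEnergy_spinPenalty` (an
  infimum of affine functions of `μ`).
* §2 STRONG DUALITY (penalty convergence): **`exists_pqgEnergy_spinPenalty_gt`**
  (`∀ ε > 0 ∃ μ, E_PQG(2n, S = 0) − ε < E_PQG(Ĥ + μŜ²; N = 2n)`; Cantor-intersection argument on the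
  compact feasible set, see the docstring), **`isLUB_pqgEnergy_spinPenalty`**,
  **`iSup_pqgEnergy_spinPenalty`** (`⨆_μ E_PQG(Ĥ + μŜ²; 2n) = E_PQG(2n, S = 0)`),
  **`tendsto_pqgEnergy_spinPenalty`** (`μ → +∞`); and THE CELL'S SECTOR FORM, squeezed between the
  `N`-form and weak duality: **`isLUB_pqgSectorEnergy_spinPenalty`**, **`iSup_pqgSectorEnergy_spinPenalty`**
  (`sup_μ E_PQG(Ĥ + μŜ²; n, n) = E_PQG(2n, S = 0)`), **`tendsto_pqgSectorEnergy_spinPenalty`**, and the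
  bound form `le_pqgSingletEnergy_iff_forall_exists_spinPenalty` (a real `c` is a singlet-restricted lower
  bound iff every `c − ε` is a plain sector lower bound of some `Ĥ + μŜ²`).

READING. What "free multiplier" means here is the supremum / limit statement; the value is NOT claimed to
be attained at a finite `μ` (exact penalty) — that would need a dual optimal multiplier for the row, a
constraint qualification this file does not assume (on the dual SOS side the `Ŝ_−Ŝ_+` ideal multipliers of
`Rows/SingletRows.lean` are sign-free, consistent with `μ ∈ ℝ`; by monotonicity only `μ → +∞` matters).
NOT here: any rate in `μ`, anything about a pinned instance, a solver run, or a certificate; no claim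
node / hint / row / CERTIFIED cell depends on this file.

Everything is PROVED (0 sorry, standard axioms); no definitions, no named facts. Generator-B independence
is untouched (tree theorems only; no generator code or instance file is read).

References: D. G. Luenberger, Y. Ye, *Linear and Nonlinear Programming* (Springer, 3rd ed. 2008) §13.1
"Penalty methods" (convergence of the penalty method: continuous objective, compact set, continuous
non-negative penalty — the argument of §2); M. Nakata, B. J. Braams, K. Fujisawa, M. Fukuda, J. K. Percus,
M. Yamashita, Z. Zhao, J. Chem. Phys. 128 (2008) 164113 §II.A–D (programme values as minima over compact
feasible sets; SDP form); D. A. Mazziotti, Adv. Chem. Phys. 134 (2007) ch. 3 §II.F.1 eqs. (96)–(98).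
Tree (REUSED): part 1 (`rdmEnergy_spinPenalty`, `re_rdmEnergy_spinPenalty`, `spinPenalty_re_nonneg`,
`spinPenalty_im_eq_zero`, `isDQGFeasibleSinglet_of_spinPenalty_eq_zero`,
`rdmEnergy_spinPenalty_of_isDQGFeasibleSinglet`); `pqgEnergy(_le_rdmEnergy)`, `pqgEnergySet_nonempty`,
`exists_isDQGFeasible_rdmEnergy_eq_pqgEnergy`, `isCompact_setOf_isDQGFeasible`,
`isClosed_setOf_isDQGFeasible`, `continuous_rdmEnergy`, `pqgSectorEnergy(_le_rdmEnergy)`,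
`pqgSectorEnergySet_nonempty`, `pqgEnergy_le_pqgSectorEnergy`, `pqgSingletEnergy(_le_rdmEnergy)`,
`pqgSingletEnergySet_nonempty` (typer). Mathlib:
`IsCompact.nonempty_iInter_of_sequence_nonempty_isCompact_isClosed` (Cantor), `exists_nat_gt`,
`tendsto_atTop_isLUB`, `IsLUB.ciSup_eq`, `ConcaveOn`.
-/

noncomputable section

namespace Summit.Ventures.CertifiedQuantumChemistry

open Matrix Finset Filter Topology
open Literature.MathematicalPhysics.QuantumLattice Literature.MathematicalPhysics.QuantumChemistry
open scoped ComplexOrder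

variable {Λ : Type*} [LinearOrder Λ] [Fintype Λ]

/-! ### §1 Weak duality, monotonicity, concavity -/

section Weak

variable (h : Λ → Λ → ℂ) (g : Λ → Λ → Λ → Λ → ℂ) (hnuc : ℂ) {n : ℕ}

omit [LinearOrder Λ] in
/-- `n ≤ |Λ|` gives a non-trivial `N = 2n` sector of the spin-orbital space. -/
private theorem add_self_le_card_orb (hn : n ≤ Fintype.card Λ) : n + n ≤ Fintype.card (Orb Λ) := by
  rw [Fintype.card_lex, Fintype.card_prod, Fintype.card_fin]
  omega

/-- **WEAK DUALITY, `N`-programme**: for every real `μ`, `E_PQG(Ĥ + μŜ²; N = 2n) ≤ E_PQG(2n, S = 0)`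
(the singlet-feasible pairs are DQG-feasible and the penalty vanishes on them). -/
theorem pqgEnergy_spinPenalty_le_pqgSingletEnergy (hn : n ≤ Fintype.card Λ) (μ : ℝ) :
    pqgEnergy h (fun p q r s => g p q r s - (μ : ℂ) * (if q = r ∧ p = s then 1 else 0))
        (hnuc + (μ : ℂ) * ((n : ℂ) * (2 - (n : ℂ)))) (n + n) ≤ pqgSingletEnergy h g hnuc n := by
  refine le_csInf (pqgSingletEnergySet_nonempty h g hnuc hn) ?_
  rintro E ⟨γ, Γ, hf, rfl⟩
  have hle := pqgEnergy_le_rdmEnergy h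
    (fun p q r s => g p q r s - (μ : ℂ) * (if q = r ∧ p = s then 1 else 0))
    (hnuc + (μ : ℂ) * ((n : ℂ) * (2 - (n : ℂ)))) hf.dqg
  rwa [rdmEnergy_spinPenalty_of_isDQGFeasibleSinglet h g hnuc (μ : ℂ) hf] at hle

/-- **WEAK DUALITY, sector programme**: `E_PQG(Ĥ + μŜ²; n, n) ≤ E_PQG(2n, S = 0)` for every real `μ`. -/
theorem pqgSectorEnergy_spinPenalty_le_pqgSingletEnergy (hn : n ≤ Fintype.card Λ) (μ : ℝ) :
    pqgSectorEnergy h (fun p q r s => g p q r s - (μ : ℂ) * (if q = r ∧ p = s then 1 else 0))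
        (hnuc + (μ : ℂ) * ((n : ℂ) * (2 - (n : ℂ)))) n n ≤ pqgSingletEnergy h g hnuc n := by
  refine le_csInf (pqgSingletEnergySet_nonempty h g hnuc hn) ?_
  rintro E ⟨γ, Γ, hf, rfl⟩
  have hle := pqgSectorEnergy_le_rdmEnergy h
    (fun p q r s => g p q r s - (μ : ℂ) * (if q = r ∧ p = s then 1 else 0))
    (hnuc + (μ : ℂ) * ((n : ℂ) * (2 - (n : ℂ)))) hf.toIsDQGFeasibleSector
  rwa [rdmEnergy_spinPenalty_of_isDQGFeasibleSinglet h g hnuc (μ : ℂ) hf] at hle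

/-- `E_PQG(Ĥ + μŜ²; 2n) ≤ E_PQG(Ĥ + μŜ²; n, n)` (the sector programme has more rows). -/
theorem pqgEnergy_spinPenalty_le_pqgSectorEnergy_spinPenalty (hn : n ≤ Fintype.card Λ) (μ : ℝ) :
    pqgEnergy h (fun p q r s => g p q r s - (μ : ℂ) * (if q = r ∧ p = s then 1 else 0))
        (hnuc + (μ : ℂ) * ((n : ℂ) * (2 - (n : ℂ)))) (n + n) ≤
      pqgSectorEnergy h (fun p q r s => g p q r s - (μ : ℂ) * (if q = r ∧ p = s then 1 else 0))
        (hnuc + (μ : ℂ) * ((n : ℂ) * (2 - (n : ℂ)))) n n :=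
  pqgEnergy_le_pqgSectorEnergy h _ _ hn hn

/-- **MONOTONICITY, `N`-programme**: `μ ↦ E_PQG(Ĥ + μŜ²; 2n)` is non-decreasing (the penalty is
non-negative on the feasible set). -/
theorem monotone_pqgEnergy_spinPenalty (hn : n ≤ Fintype.card Λ) :
    Monotone fun μ : ℝ => pqgEnergy h (fun p q r s => g p q r s - (μ : ℂ) * (if q = r ∧ p = s then 1 else 0))
      (hnuc + (μ : ℂ) * ((n : ℂ) * (2 - (n : ℂ)))) (n + n) := by
  intro μ μ' hμ
  dsimp only
  refine le_csInf (pqgEnergySet_nonempty h _ _ (add_self_le_card_orb hn)) ?_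
  rintro E ⟨γ, Γ, hf, rfl⟩
  refine (pqgEnergy_le_rdmEnergy h _ _ hf).trans ?_
  rw [re_rdmEnergy_spinPenalty, re_rdmEnergy_spinPenalty]
  exact add_le_add le_rfl (mul_le_mul_of_nonneg_right hμ (spinPenalty_re_nonneg hf))

/-- **MONOTONICITY, sector programme**: `μ ↦ E_PQG(Ĥ + μŜ²; n, n)` is non-decreasing. -/
theorem monotone_pqgSectorEnergy_spinPenalty (hn : n ≤ Fintype.card Λ) :
    Monotone fun μ : ℝ => pqgSectorEnergy h
      (fun p q r s => g p q r s - (μ : ℂ) * (if q = r ∧ p = s then 1 else 0))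
      (hnuc + (μ : ℂ) * ((n : ℂ) * (2 - (n : ℂ)))) n n := by
  intro μ μ' hμ
  dsimp only
  refine le_csInf (pqgSectorEnergySet_nonempty h _ _ hn hn) ?_
  rintro E ⟨γ, Γ, hf, rfl⟩
  refine (pqgSectorEnergy_le_rdmEnergy h _ _ hf).trans ?_
  rw [re_rdmEnergy_spinPenalty, re_rdmEnergy_spinPenalty]
  exact add_le_add le_rfl (mul_le_mul_of_nonneg_right hμ (spinPenalty_re_nonneg hf.dqg))

/-- **CONCAVITY**: `μ ↦ E_PQG(Ĥ + μŜ²; 2n)` is concave on `ℝ` (an infimum of affine functions of `μ`). -/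
theorem concaveOn_pqgEnergy_spinPenalty (hn : n ≤ Fintype.card Λ) :
    ConcaveOn ℝ Set.univ fun μ : ℝ => pqgEnergy h
      (fun p q r s => g p q r s - (μ : ℂ) * (if q = r ∧ p = s then 1 else 0))
      (hnuc + (μ : ℂ) * ((n : ℂ) * (2 - (n : ℂ)))) (n + n) := by
  refine ⟨convex_univ, fun μ _ μ' _ a b ha hb hab => ?_⟩
  dsimp only
  refine le_csInf (pqgEnergySet_nonempty h _ _ (add_self_le_card_orb hn)) ?_
  rintro E ⟨γ, Γ, hf, rfl⟩
  have h1 := pqgEnergy_le_rdmEnergy h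
    (fun p q r s => g p q r s - (μ : ℂ) * (if q = r ∧ p = s then 1 else 0))
    (hnuc + (μ : ℂ) * ((n : ℂ) * (2 - (n : ℂ)))) hf
  have h2 := pqgEnergy_le_rdmEnergy h
    (fun p q r s => g p q r s - (μ' : ℂ) * (if q = r ∧ p = s then 1 else 0))
    (hnuc + (μ' : ℂ) * ((n : ℂ) * (2 - (n : ℂ)))) hf
  rw [re_rdmEnergy_spinPenalty] at h1 h2
  simp only [smul_eq_mul]
  rw [re_rdmEnergy_spinPenalty]
  set e := (rdmEnergy h g hnuc γ Γ).re
  set π := ((n : ℂ) * (2 - (n : ℂ)) - (1 / 2 : ℂ) * ∑ σ : Fin 2, ∑ τ : Fin 2, ∑ p : Λ, ∑ q : Λ,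
    Γ (orb p σ, orb q τ) (orb q σ, orb p τ)).re
  have ha1 := mul_le_mul_of_nonneg_left h1 ha
  have hb2 := mul_le_mul_of_nonneg_left h2 hb
  have key : a * (e + μ * π) + b * (e + μ' * π) = e + (a * μ + b * μ') * π := by
    calc a * (e + μ * π) + b * (e + μ' * π) = (a + b) * e + (a * μ + b * μ') * π := by ring
      _ = e + (a * μ + b * μ') * π := by rw [hab, one_mul]
  linarith

end Weak

/-! ### §2 Strong duality: the penalised values converge to the singlet value (compactness) -/

section Strong

variable (h : Λ → Λ → ℂ) (g : Λ → Λ → Λ → Λ → ℂ) (hnuc : ℂ) {n : ℕ}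

/-- **STRONG DUALITY (penalty convergence), `N`-programme.** For every `ε > 0` some multiplier `μ`
brings the penalised DQG value within `ε` of the singlet-restricted value:
`E_PQG(2n, S = 0) − ε < E_PQG(Ĥ + μŜ²; N = 2n)`. Proof: otherwise the closed sets
`A_m = {x feasible | E(x) + m·P(x) ≤ E_S − ε}` (`m = 0, 1, 2, …`) of the COMPACT feasible set are
non-empty (the penalised values are attained, `RelaxationEnergyAttained`) and nested (`P ≥ 0`), so they
share a point (Cantor); its penalty is `0` (Archimedes), so it is singlet-feasible with energy
`≤ E_S − ε < E_S` — contradiction. No constraint qualification is used. -/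
theorem exists_pqgEnergy_spinPenalty_gt (hn : n ≤ Fintype.card Λ) {ε : ℝ} (hε : 0 < ε) :
    ∃ μ : ℝ, pqgSingletEnergy h g hnuc n - ε <
      pqgEnergy h (fun p q r s => g p q r s - (μ : ℂ) * (if q = r ∧ p = s then 1 else 0))
        (hnuc + (μ : ℂ) * ((n : ℂ) * (2 - (n : ℂ)))) (n + n) := by
  have hN : n + n ≤ Fintype.card (Orb Λ) := by
    rw [Fintype.card_lex, Fintype.card_prod, Fintype.card_fin]
    omega
  by_contra hcon
  simp only [not_exists, not_lt] at hcon
  -- abbreviations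
  set ES := pqgSingletEnergy h g hnuc n with hES
  set E0 := pqgEnergy h g hnuc (n + n) with hE0
  -- the penalty functional and the energy, as real functions on the pair space
  let P : Matrix (Orb Λ) (Orb Λ) ℂ × Matrix (Orb Λ × Orb Λ) (Orb Λ × Orb Λ) ℂ → ℝ := fun x =>
    ((n : ℂ) * (2 - (n : ℂ)) - (1 / 2 : ℂ) * ∑ σ : Fin 2, ∑ τ : Fin 2, ∑ p : Λ, ∑ q : Λ,
      x.2 (orb p σ, orb q τ) (orb q σ, orb p τ)).re
  let E : Matrix (Orb Λ) (Orb Λ) ℂ × Matrix (Orb Λ × Orb Λ) (Orb Λ × Orb Λ) ℂ → ℝ := fun x =>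
    (rdmEnergy h g hnuc x.1 x.2).re
  have hPcont : Continuous P := by
    refine Complex.continuous_re.comp (continuous_const.sub (continuous_const.mul ?_))
    exact continuous_finsetSum _ fun σ _ => continuous_finsetSum _ fun τ _ =>
      continuous_finsetSum _ fun p _ => continuous_finsetSum _ fun q _ => continuous_snd.matrix_elem _ _
  have hEcont : Continuous E := Complex.continuous_re.comp (continuous_rdmEnergy h g hnuc)
  -- minimisers of the penalised programmes at `μ = m`
  have hmin : ∀ m : ℕ, ∃ x : Matrix (Orb Λ) (Orb Λ) ℂ × Matrix (Orb Λ × Orb Λ) (Orb Λ × Orb Λ) ℂ,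
      IsDQGFeasible (n + n) x.1 x.2 ∧ E x + m * P x ≤ ES - ε := by
    intro m
    obtain ⟨γ, Γ, hf, hval⟩ := exists_isDQGFeasible_rdmEnergy_eq_pqgEnergy h
      (fun p q r s => g p q r s - ((m : ℝ) : ℂ) * (if q = r ∧ p = s then 1 else 0))
      (hnuc + ((m : ℝ) : ℂ) * ((n : ℂ) * (2 - (n : ℂ)))) hN
    refine ⟨(γ, Γ), hf, ?_⟩
    have := hcon (m : ℝ)
    rw [← hval, re_rdmEnergy_spinPenalty] at this
    exact this
  -- the nested closed sets `A_m = {x feasible | E x + m P x ≤ ES − ε}` of the compact feasible set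
  let A : ℕ → Set (Matrix (Orb Λ) (Orb Λ) ℂ × Matrix (Orb Λ × Orb Λ) (Orb Λ × Orb Λ) ℂ) := fun m =>
    {x | IsDQGFeasible (n + n) x.1 x.2 ∧ E x + m * P x ≤ ES - ε}
  have hAcl : ∀ m, IsClosed (A m) := fun m =>
    (isClosed_setOf_isDQGFeasible (ι := Orb Λ) (n + n)).inter
      (isClosed_le (hEcont.add (continuous_const.mul hPcont)) continuous_const)
  have hA0 : IsCompact (A 0) :=
    (isCompact_setOf_isDQGFeasible (ι := Orb Λ) (n + n)).of_isClosed_subset (hAcl 0) fun x hx => hx.1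
  have hAd : ∀ m, A (m + 1) ⊆ A m := by
    rintro m x ⟨hxf, hxle⟩
    refine ⟨hxf, le_trans ?_ hxle⟩
    have hP := spinPenalty_re_nonneg hxf
    push_cast
    nlinarith
  have hAne : ∀ m, (A m).Nonempty := fun m => by
    obtain ⟨x, hxf, hxle⟩ := hmin m
    exact ⟨x, hxf, hxle⟩
  obtain ⟨a, ha⟩ := IsCompact.nonempty_iInter_of_sequence_nonempty_isCompact_isClosed A hAd hAne hA0 hAcl
  have haA : ∀ m, a ∈ A m := fun m => Set.mem_iInter.1 ha m
  have haf : IsDQGFeasible (n + n) a.1 a.2 := (haA 0).1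
  -- the common point has penalty `0` (Archimedes) …
  have hE0a : E0 ≤ E a := pqgEnergy_le_rdmEnergy h g hnuc haf
  have hPa : P a = 0 := by
    have hP0 := spinPenalty_re_nonneg haf
    by_contra hne
    have hPpos : 0 < P a := lt_of_le_of_ne hP0 (Ne.symm hne)
    obtain ⟨m, hm⟩ := exists_nat_gt ((ES - ε - E0) / P a)
    have h1 : (m : ℝ) * P a ≤ ES - ε - E0 := by linarith [(haA m).2]
    have h2 : (ES - ε - E0) / P a < (m : ℝ) := hm
    rw [div_lt_iff₀ hPpos] at h2
    linarith
  -- … so it is singlet-feasible, with energy `≤ ES − ε`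
  have hPa' : (n : ℂ) * (2 - (n : ℂ)) - (1 / 2 : ℂ) * ∑ σ : Fin 2, ∑ τ : Fin 2, ∑ p : Λ, ∑ q : Λ,
      a.2 (orb p σ, orb q τ) (orb q σ, orb p τ) = 0 :=
    Complex.ext (by rw [Complex.zero_re]; exact hPa) (by rw [Complex.zero_im]; exact spinPenalty_im_eq_zero haf)
  have haS : IsDQGFeasibleSinglet n a.1 a.2 := isDQGFeasibleSinglet_of_spinPenalty_eq_zero haf hPa'
  have hEa : E a ≤ ES - ε := by simpa using (haA 0).2
  have hSa : ES ≤ E a := pqgSingletEnergy_le_rdmEnergy h g hnuc haS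
  linarith

/-- **`E_PQG(2n, S = 0)` is the least upper bound of the penalised `N`-programme values.** -/
theorem isLUB_pqgEnergy_spinPenalty (hn : n ≤ Fintype.card Λ) :
    IsLUB (Set.range fun μ : ℝ => pqgEnergy h
      (fun p q r s => g p q r s - (μ : ℂ) * (if q = r ∧ p = s then 1 else 0))
      (hnuc + (μ : ℂ) * ((n : ℂ) * (2 - (n : ℂ)))) (n + n)) (pqgSingletEnergy h g hnuc n) := by
  refine ⟨?_, fun b hb => ?_⟩
  · rintro _ ⟨μ, rfl⟩
    exact pqgEnergy_spinPenalty_le_pqgSingletEnergy h g hnuc hn μ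
  · by_contra hlt
    obtain ⟨μ, hμ⟩ := exists_pqgEnergy_spinPenalty_gt h g hnuc hn (sub_pos.2 (not_le.1 hlt))
    have := hb ⟨μ, rfl⟩
    linarith

/-- **`sup_μ E_PQG(Ĥ + μŜ²; N = 2n) = E_PQG(2n, S = 0)`** — the singlet row as a free multiplier on the
spin-free square, `N`-programme form. -/
theorem iSup_pqgEnergy_spinPenalty (hn : n ≤ Fintype.card Λ) :
    ⨆ μ : ℝ, pqgEnergy h (fun p q r s => g p q r s - (μ : ℂ) * (if q = r ∧ p = s then 1 else 0))
      (hnuc + (μ : ℂ) * ((n : ℂ) * (2 - (n : ℂ)))) (n + n) = pqgSingletEnergy h g hnuc n :=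
  (isLUB_pqgEnergy_spinPenalty h g hnuc hn).ciSup_eq

/-- **Penalty convergence**: `E_PQG(Ĥ + μŜ²; N = 2n) → E_PQG(2n, S = 0)` as `μ → +∞` (monotonically). -/
theorem tendsto_pqgEnergy_spinPenalty (hn : n ≤ Fintype.card Λ) :
    Tendsto (fun μ : ℝ => pqgEnergy h (fun p q r s => g p q r s - (μ : ℂ) * (if q = r ∧ p = s then 1 else 0))
      (hnuc + (μ : ℂ) * ((n : ℂ) * (2 - (n : ℂ)))) (n + n)) atTop (𝓝 (pqgSingletEnergy h g hnuc n)) :=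
  tendsto_atTop_isLUB (monotone_pqgEnergy_spinPenalty h g hnuc hn) (isLUB_pqgEnergy_spinPenalty h g hnuc hn)

/-- **THE CELL'S FORM (sector programme): `sup_μ E_PQG(Ĥ + μŜ²; n, n) = E_PQG(2n, S = 0)`** — the
`DQG+S²` value is the supremum over the free multiplier `μ` of the plain `S_z = 0`-sector DQG values of
`Ĥ + μŜ²` (STRUCTURE §2.2.1 (ii)); squeezed between the `N`-programme form and weak duality. -/
theorem isLUB_pqgSectorEnergy_spinPenalty (hn : n ≤ Fintype.card Λ) :
    IsLUB (Set.range fun μ : ℝ => pqgSectorEnergy h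
      (fun p q r s => g p q r s - (μ : ℂ) * (if q = r ∧ p = s then 1 else 0))
      (hnuc + (μ : ℂ) * ((n : ℂ) * (2 - (n : ℂ)))) n n) (pqgSingletEnergy h g hnuc n) := by
  refine ⟨?_, fun b hb => ?_⟩
  · rintro _ ⟨μ, rfl⟩
    exact pqgSectorEnergy_spinPenalty_le_pqgSingletEnergy h g hnuc hn μ
  · by_contra hlt
    obtain ⟨μ, hμ⟩ := exists_pqgEnergy_spinPenalty_gt h g hnuc hn (sub_pos.2 (not_le.1 hlt))
    have h1 := hb ⟨μ, rfl⟩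
    have h2 := pqgEnergy_spinPenalty_le_pqgSectorEnergy_spinPenalty h g hnuc hn μ
    simp only at h1
    linarith

/-- `⨆_μ E_PQG(Ĥ + μŜ²; n, n) = E_PQG(2n, S = 0)`. -/
theorem iSup_pqgSectorEnergy_spinPenalty (hn : n ≤ Fintype.card Λ) :
    ⨆ μ : ℝ, pqgSectorEnergy h (fun p q r s => g p q r s - (μ : ℂ) * (if q = r ∧ p = s then 1 else 0))
      (hnuc + (μ : ℂ) * ((n : ℂ) * (2 - (n : ℂ)))) n n = pqgSingletEnergy h g hnuc n :=
  (isLUB_pqgSectorEnergy_spinPenalty h g hnuc hn).ciSup_eq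

/-- **Penalty convergence, sector form**: `E_PQG(Ĥ + μŜ²; n, n) → E_PQG(2n, S = 0)` as `μ → +∞`. -/
theorem tendsto_pqgSectorEnergy_spinPenalty (hn : n ≤ Fintype.card Λ) :
    Tendsto (fun μ : ℝ => pqgSectorEnergy h
      (fun p q r s => g p q r s - (μ : ℂ) * (if q = r ∧ p = s then 1 else 0))
      (hnuc + (μ : ℂ) * ((n : ℂ) * (2 - (n : ℂ)))) n n) atTop (𝓝 (pqgSingletEnergy h g hnuc n)) :=
  tendsto_atTop_isLUB (monotone_pqgSectorEnergy_spinPenalty h g hnuc hn)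
    (isLUB_pqgSectorEnergy_spinPenalty h g hnuc hn)

/-- **Every penalised value is a valid singlet-restricted lower bound, and they exhaust it**: a real `c`
satisfies `c ≤ E_PQG(2n, S = 0)` iff for every `ε > 0` some `μ` gives `c − ε ≤ E_PQG(Ĥ + μŜ²; n, n)`. -/
theorem le_pqgSingletEnergy_iff_forall_exists_spinPenalty (hn : n ≤ Fintype.card Λ) (c : ℝ) :
    c ≤ pqgSingletEnergy h g hnuc n ↔ ∀ ε > 0, ∃ μ : ℝ, c - ε ≤ pqgSectorEnergy h
      (fun p q r s => g p q r s - (μ : ℂ) * (if q = r ∧ p = s then 1 else 0))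
      (hnuc + (μ : ℂ) * ((n : ℂ) * (2 - (n : ℂ)))) n n := by
  constructor
  · intro hc ε hε
    obtain ⟨μ, hμ⟩ := exists_pqgEnergy_spinPenalty_gt h g hnuc hn hε
    exact ⟨μ, by linarith [pqgEnergy_spinPenalty_le_pqgSectorEnergy_spinPenalty h g hnuc hn μ]⟩
  · intro hc
    refine le_of_forall_pos_lt_add fun ε hε => ?_
    obtain ⟨μ, hμ⟩ := hc (ε / 2) (half_pos hε)
    linarith [pqgSectorEnergy_spinPenalty_le_pqgSingletEnergy h g hnuc hn μ]

end Strong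

end Summit.Ventures.CertifiedQuantumChemistry

end
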